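import Mathlib
import Summits.ValiantsHypothesis.ValiantsHypothesis.Theses.FreeSubtorus
import Summits.ValiantsHypothesis.ValiantsHypothesis.Cruxes.OrbitDimensionBound.Lines.ChannelLadder
import Literature.Computability.AlgebraicComplexity.LandsbergRessayreNormalForm
import Literature.Computability.AlgebraicComplexity.LRPencilOfMatrix

/-!
# Line `channel_covering` — skeleton for the rung `OneChannelShadow` (one-channel equivariant covering bound)

Crux advanced: `OrbitDimensionBound` (stmt-ValiantsHypothesis-16133) of `route-ValiantsHypothesis-FreeSubtorus`; floor
`SubtorusCovering` (PROVED, `subtorusCovering_proof` = `Channel.channelCovering_zero` up to `Iff`); rung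
`Channel.OneChannelShadow` (`Lines/ChannelLadder.lean`; numeric hub `Channel.OneChannelCovering = ChannelCovering 1`:
`C(n,⌊n/2⌋) ≤ n · m² · 4^r` for a ONE-CHANNEL `T_Λ`-equivariant affine determinantal expression `B = B_eq + u vᵀ`
of `per_n`, `n ≥ 3`).

THE LINE.  `OneChannelShadow ⇐ OneChannelCovering` (ladder file), and `OneChannelCovering` from three registered stubs:
* `stub_channelGradedForm` (S/M; the landed floor machinery applied to `B_eq = B - u vᵀ`): a generic element
  `t₀ = diag(d_k e_l) ∈ T_Λ` (`FreeSubtorusConfusionCovering.stub_genericElement`: relations of `Λ`, no non-negative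
  multiplicative relation among the `d_k e_l`, characters separated exactly modulo `ℚΛ`) and ONE lift `(g, h)` of it
  for `B_eq` put `B`, after a base change `P, Q ∈ GL_m(ℂ)`, in the form `P B Q = M + u' v'ᵀ` with `M` affine and
  GRADED (`exists_gradedForm` on `B_eq`: row grades `β`, column grades `α` = generalised eigenvalues of the lift;
  `M₀[i,j] ≠ 0 ⇒ β_i = α_j`, `M_{x_kl}[i,j] ≠ 0 ⇒ β_i = d_k e_l α_j`) and `u' v'ᵀ = P u vᵀ Q` constant of rank `≤ 1`
  (`IsGradedChannelForm`).  No determinant is used.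
* `stub_channelChains` (L; NEW — the load-bearing core): if moreover `det B = per_n` then EVERY permutation `σ ∈ S_n`
  is SERVED (`Served`): either ONE graded chain carries `⌊n/2⌋` of its variables — `β_i = α_j · ∏_{k ∈ T} d_k e_{σ k}`
  for some `i, j` and `|T| = ⌊n/2⌋` — or the TWO chains issuing from two FIXED rows `s₁, s₂` (the unmatched rows of
  `M₀`, independent of `σ`) carry `⌊n/2⌋` of them jointly.  (Matrix determinant lemma
  `c · per_n = det M + v'ᵀ adj(M) u'`, `c = det P det Q ≠ 0`; the coefficient of `x_σ = ∏ x_{k σ(k)}` is non-zero in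
  `det M` or in some first minor of `M`; a Leibniz term of that (graded, affine) determinant reaching `x_σ`
  (`exists_perm_embedding_of_coeff_det_ne_zero`) uses `n` variable cells and otherwise cells of `M₀`, WLOG a graded
  partial permutation matrix after graded Gaussian elimination; following "variable cell → column → its `M₀`-partner
  row" decomposes the variable cells into vertex-disjoint chains and cycles; a graded CYCLE forces
  `∏_{cells} d_k e_l = 1`, excluded by genericity (ii); chains start only at unmatched rows of `M₀` (corank `≤ 2`
  since `rank(M₀ + u'v'ᵀ) = m - 1` by von zur Gathen) or at the partner row of the deleted column: `≤ 3` chains, so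
  one chain carries `≥ ⌊n/2⌋` cells or the two fixed-source chains carry `> n/2` jointly; grades telescope along a
  chain: `β_{source} = (∏_{first t cells} d_k e_{σ k}) · α_{t-th column}`.)
* `stub_servedCount` (M; Odlyzko twice + double counting, adapting the landed `stub_classCount`): if every `σ` is
  served then `C(n,⌊n/2⌋) ≤ n · m² · 4^r`.  (Label a singly-served `σ` by the pair of grade VALUES `(β_i, α_j)`
  (`≤ m²` labels) and a doubly-served one by `(α_{j₁}, α_{j₂}, |T₁|)` (`≤ m² (⌊n/2⌋+1)` labels, the sources being
  fixed); for a fixed label the level-`t` pairs `(T, σT)` with prescribed character value are pairwise CONFUSED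
  (genericity (iii)), hence `≤ 2^r` of them per chain (Odlyzko: a translate of a rank-`r` subspace of `ℚ^{2n}` holds
  `≤ 2^r` points of `{0,1}^{2n}`; admissibility keeps levels apart), and a pair, resp. a pair of pairs, is induced by
  `≤ ⌊n/2⌋! (n-⌊n/2⌋)!` permutations: `n! ≤ m² (2^r + (⌊n/2⌋+1) 4^r) ⌊n/2⌋! (n-⌊n/2⌋)!`, and
  `2^r + (⌊n/2⌋+1) 4^r ≤ n 4^r` for `n ≥ 3`.)
Composition `OneChannelCovering_of`, `OneChannelShadow_of`: kernel-checked below, sorries ONLY in `stub_*`.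

Disproof used (Cruxes/OrbitDimensionBound/Disproof.lean): honours `orbitDimensionBound_false_without_repHyp` — the
determinant hypothesis `det B = per_n` is consumed (only) in `stub_channelChains`; the relaxed target
`Channel.OrbitChannelBound 1` keeps the "replace `A` by another `B`" shape (the in-place strengthenings
`not_orbitDimensionBoundInPlace`, `not_inPlaceHomothety` are refuted); `twistedGrenet` (size 7, `per_3`, no homothety
lift): its only linear lifts up to a constant defect are scalar pairs, with defect rank `6 = m - 1` (sympy check by
this seat), so it is not a small-channel object and says nothing against `ρ = 1`.

[cite: LandsbergRessayre2017, §6, Thm. 2.8, Question 2.2] [cite: Odlyzko1988, p. 127] [cite: MignonRessayre2004]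
[folklore: matrix determinant lemma]
-/

set_option linter.dupNamespace false
set_option linter.unusedVariables false

noncomputable section

namespace Summit.ValiantsHypothesis.ValiantsHypothesis.Cruxes.OrbitDimensionBound.Channel.Line

open MvPolynomial Finset
open Literature.Computability.AlgebraicComplexity LRPencil
open Summit.ValiantsHypothesis.ValiantsHypothesis.Cruxes.OrbitDimensionBound.Channel
open Summit.ValiantsHypothesis.ValiantsHypothesis.Cruxes.OrbitDimensionBound.Torsion (subtorus)

/-! ## §1 Vocabulary of the line -/

/-- `IsGeneric n r Λ d e`: `(d, e) ∈ (ℂˣ)ⁿ × (ℂˣ)ⁿ` satisfies the relations of `T_Λ` (i), the weights `d_k e_l` have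
no non-trivial non-negative multiplicative relation (ii), and a character is trivial on `(d, e)` iff a non-zero
multiple of it lies in `ℤΛ` (iii) — verbatim the conclusion of the landed `stub_genericElement`.
[cite: LandsbergRessayre2017, §6] -/
def IsGeneric (n r : ℕ) (Λ : Fin r → (Fin n ⊕ Fin n) → ℤ) (d e : Fin n → ℂˣ) : Prop :=
  (∀ i, (∏ k, (d k) ^ (Λ i (Sum.inl k))) * (∏ l, (e l) ^ (Λ i (Sum.inr l))) = 1) ∧
  (∀ u : Fin n × Fin n → ℕ, u ≠ 0 → (∏ p, ((d p.1 : ℂ) * (e p.2 : ℂ)) ^ (u p)) ≠ 1) ∧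
  (∀ χ : (Fin n ⊕ Fin n) → ℤ,
    (∏ k, (d k) ^ (χ (Sum.inl k))) * (∏ l, (e l) ^ (χ (Sum.inr l))) = 1 →
    ∃ (N : ℤ) (a : Fin r → ℤ), N ≠ 0 ∧ N • χ = ∑ i, a i • Λ i)

/-- `IsGradedChannelForm n m B d e α β`: after a base change `P, Q ∈ GL_m(ℂ)` and removal of a constant matrix
`u vᵀ` of rank `≤ 1`, the affine matrix `M = P B Q - u vᵀ` is GRADED by column grades `α` and row grades `β` with
variable weights `d_k e_l`: `M₀[i,j] ≠ 0 ⇒ β_i = α_j` and `M_{x_{kl}}[i,j] ≠ 0 ⇒ β_i = d_k e_l α_j`.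
[cite: LandsbergRessayre2017, §6] -/
def IsGradedChannelForm (n m : ℕ) (B : Matrix (Fin m) (Fin m) (MvPolynomial (Fin n × Fin n) ℂ))
    (d e : Fin n → ℂˣ) (α β : Fin m → ℂ) : Prop :=
  ∃ (P Q : GL (Fin m) ℂ) (u v : Fin m → ℂ),
    (∀ i j, constPart ((P : Matrix (Fin m) (Fin m) ℂ).map C * B * (Q : Matrix (Fin m) (Fin m) ℂ).map C -
        (Matrix.vecMulVec u v).map C) i j ≠ 0 → β i = α j) ∧
    (∀ (p : Fin n × Fin n) i j,
      coeffMat ((P : Matrix (Fin m) (Fin m) ℂ).map C * B * (Q : Matrix (Fin m) (Fin m) ℂ).map C -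
        (Matrix.vecMulVec u v).map C) p i j ≠ 0 → β i = (d p.1 : ℂ) * (e p.2 : ℂ) * α j)

/-- The torus weight picked up by a graded chain carrying the variable cells `{(k, σ k) : k ∈ T}`. [folklore] -/
def chainWt {n : ℕ} (d e : Fin n → ℂˣ) (σ : Equiv.Perm (Fin n)) (T : Finset (Fin n)) : ℂ :=
  ∏ k ∈ T, ((d k : ℂ) * (e (σ k) : ℂ))

/-- `Served n m d e α β s₁ s₂ σ`: the permutation `σ` is reached at depth `⌊n/2⌋` by ONE graded chain
(`β_i = chainWt(σ|T) · α_j`, `|T| = ⌊n/2⌋`, any reference row `i`), or JOINTLY by the two chains issuing from the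
fixed source rows `s₁, s₂` (`|T₁| + |T₂| = ⌊n/2⌋`, `T₁ ∩ T₂ = ∅`). [cite: LandsbergRessayre2017, §6] -/
def Served (n m : ℕ) (d e : Fin n → ℂˣ) (α β : Fin m → ℂ) (s₁ s₂ : Fin m) (σ : Equiv.Perm (Fin n)) : Prop :=
  (∃ (i j : Fin m) (T : Finset (Fin n)), T.card = n / 2 ∧ β i = chainWt d e σ T * α j) ∨
  (∃ (j₁ j₂ : Fin m) (T₁ T₂ : Finset (Fin n)), Disjoint T₁ T₂ ∧ T₁.card + T₂.card = n / 2 ∧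
    β s₁ = chainWt d e σ T₁ * α j₁ ∧ β s₂ = chainWt d e σ T₂ * α j₂)

/-! ## §2 The registered stubs -/

/-- Statement of `stub_channelGradedForm`. -/
def Stmt.stub_channelGradedForm : Prop :=
  ∀ (n m r : ℕ) (Λ : Fin r → (Fin n ⊕ Fin n) → ℤ) (B : Matrix (Fin m) (Fin m) (MvPolynomial (Fin n × Fin n) ℂ)),
    3 ≤ n → (∀ i, (∑ k, Λ i (Sum.inl k)) = 0 ∧ (∑ l, Λ i (Sum.inr l)) = 0) →
    IsChannelDetRepr 1 (subtorus n r Λ) (perPoly (Fin n) ℂ) B →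
    ∃ (d e : Fin n → ℂˣ) (α β : Fin m → ℂ), IsGeneric n r Λ d e ∧ IsGradedChannelForm n m B d e α β

/-- Statement of `stub_channelChains`. -/
def Stmt.stub_channelChains : Prop :=
  ∀ (n m r : ℕ) (Λ : Fin r → (Fin n ⊕ Fin n) → ℤ) (B : Matrix (Fin m) (Fin m) (MvPolynomial (Fin n × Fin n) ℂ))
    (d e : Fin n → ℂˣ) (α β : Fin m → ℂ),
    3 ≤ n → IsAffineDetRepr (perPoly (Fin n) ℂ) B → IsGeneric n r Λ d e → IsGradedChannelForm n m B d e α β →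
    ∃ s₁ s₂ : Fin m, ∀ σ : Equiv.Perm (Fin n), Served n m d e α β s₁ s₂ σ

/-- Statement of `stub_servedCount`. -/
def Stmt.stub_servedCount : Prop :=
  ∀ (n m r : ℕ) (Λ : Fin r → (Fin n ⊕ Fin n) → ℤ) (d e : Fin n → ℂˣ) (α β : Fin m → ℂ) (s₁ s₂ : Fin m),
    3 ≤ n → (∀ i, (∑ k, Λ i (Sum.inl k)) = 0 ∧ (∑ l, Λ i (Sum.inr l)) = 0) → IsGeneric n r Λ d e →
    (∀ σ : Equiv.Perm (Fin n), Served n m d e α β s₁ s₂ σ) →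
    Nat.choose n (n / 2) ≤ m * (n * m) * 2 ^ (2 * r)

/-- **Stub 1 (S/M) — graded one-channel form.**  Generic element of `T_Λ` + one lift for `B - u vᵀ` + bases adapted
to the generalised eigenspaces of the lift (landed: `stub_genericElement`, `exists_gradedForm`,
`mul_constPart_eq_of_linSubstEntries_eq`, `coeffMat_linSubstEntries`); `P (u vᵀ) Q = (P u)(vᵀ Q)`.
[cite: LandsbergRessayre2017, §6] -/
theorem stub_channelGradedForm : Stmt.stub_channelGradedForm := by
  sorry

/-- **Stub 2 (L, NEW core) — every permutation is served by one chain or by the two fixed-source chains.**  Matrix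
determinant lemma, Leibniz extraction in `det M` and its first minors, graded Gaussian elimination of `M₀`, no graded
cycles (genericity (ii)), `≤ 3` chains (corank `M₀ ≤ 2` by von zur Gathen regularity of `B`), telescoping grades.
[cite: LandsbergRessayre2017, §6] [cite: vonzurGathen1987] [folklore: matrix determinant lemma] -/
theorem stub_channelChains : Stmt.stub_channelChains := by
  sorry

/-- **Stub 3 (M) — the served count.**  Odlyzko's hypercube lemma at two levels (genericity (iii) makes equal
character values a confusion class; `≤ 2^r` pairs per class, cf. the landed `stub_classCount`) and double counting:
`n! ≤ m² (2^r + (⌊n/2⌋+1) 4^r) ⌊n/2⌋! (n-⌊n/2⌋)! ≤ n m² 4^r ⌊n/2⌋! (n-⌊n/2⌋)!`.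
[cite: Odlyzko1988, p. 127] [cite: LandsbergRessayre2017, §6] -/
theorem stub_servedCount : Stmt.stub_servedCount := by
  sorry

/-! ## §3 The composition (kernel-checked, sorry-free) -/

/-- **`OneChannelCovering` from the three stubs**: graded form ⇒ chains ⇒ count.
[cite: LandsbergRessayre2017, Thm. 2.8, Question 2.2] -/
theorem OneChannelCovering_of :
    Stmt.stub_channelGradedForm → Stmt.stub_channelChains → Stmt.stub_servedCount → OneChannelCovering := by
  intro hGF hCh hSC
  refine oneChannelCovering_iff.2 fun n hn m r Λ B hΛ hB => ?_
  obtain ⟨d, e, α, β, hgen, hform⟩ := hGF n m r Λ B hn hΛ hB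
  obtain ⟨s₁, s₂, hserved⟩ := hCh n m r Λ B d e α β hn hB.1 hgen hform
  exact hSC n m r Λ d e α β s₁ s₂ hn hΛ hgen hserved

/-- **THE RUNG from the three stubs** (concludes `Channel.OneChannelShadow` BY NAME).
[cite: LandsbergRessayre2017, Question 2.2] -/
theorem OneChannelShadow_of :
    Stmt.stub_channelGradedForm → Stmt.stub_channelChains → Stmt.stub_servedCount →
      Summit.ValiantsHypothesis.ValiantsHypothesis.Cruxes.OrbitDimensionBound.Channel.OneChannelShadow :=
  fun h₁ h₂ h₃ => oneChannelShadow_of_oneChannelCovering (OneChannelCovering_of h₁ h₂ h₃)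

/-- **THE SKELETON: the rung modulo exactly the three registered stubs.** [cite: LandsbergRessayre2017, Question 2.2] -/
theorem OneChannelShadow_proof :
    Summit.ValiantsHypothesis.ValiantsHypothesis.Cruxes.OrbitDimensionBound.Channel.OneChannelShadow :=
  OneChannelShadow_of stub_channelGradedForm stub_channelChains stub_servedCount

/-- The numeric member modulo the stubs. [cite: LandsbergRessayre2017, Question 2.2] -/
theorem OneChannelCovering_proof : OneChannelCovering :=
  OneChannelCovering_of stub_channelGradedForm stub_channelChains stub_servedCount

/-- The floor again, from the stubs (rung ⇒ floor, shadow currency). [cite: LandsbergRessayre2017, Thm. 2.8] -/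
theorem floorShadow_of_stubs :
    Stmt.stub_channelGradedForm → Stmt.stub_channelChains → Stmt.stub_servedCount → ChannelShadow 0 :=
  fun h₁ h₂ h₃ => channelShadow_zero_of_oneChannelShadow (OneChannelShadow_of h₁ h₂ h₃)

/-- How the line advances the open crux: with the stubs, the RELAXED symmetrisation target suffices —
`OrbitChannelBound 1 → VP ≠ VNP` (`closes_channel`). [cite: LandsbergRessayre2017, Question 2.2] -/
theorem vh_of_orbitChannelBound_of_stubs :
    Stmt.stub_channelGradedForm → Stmt.stub_channelChains → Stmt.stub_servedCount →
      OrbitChannelBound 1 → _root_.ValiantsHypothesis :=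
  fun h₁ h₂ h₃ h => closes_channel h (OneChannelCovering_of h₁ h₂ h₃)

end Summit.ValiantsHypothesis.ValiantsHypothesis.Cruxes.OrbitDimensionBound.Channel.Line

end
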